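import Summits.NavierStokesRegularity.FunctionalMining.StretchingLaminateL1SuperTree
import HarnessLib

/-!
# FunctionalMining — K1-Q1 laminates, L1 port 2/18 — Parts C–D (concavity along admissible lines; unit directions in the open ball)

search for candidate a priori estimates; no regularity claim.

Cell `pub-nsfunc` (host summit NavierStokesRegularity, topic `FunctionalMining`); PORT COPY of the bank seat's scratch
`HOME/pub-nsfunc-bank/tools/lam/upper/u4t/L1-SUPERSOLUTION.scratch.lean` (generic r11, sha16 c63cd257e1f26cb9), lines 434–715,
verbatim EXCEPT docstrings (overlay `u4t/port/docstrings_r11.json` c4f7e1e1d014a584 = split plan `u4t/PORT-SPLIT-PLAN.md` §4 (E2)/(E3):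
new one-line docstrings on formerly undocumented helpers + refreshed hypothesis/proved-downstream docstrings on the `Prop`s;
provenance tags `[ours; …]` appended to every other docstring (tags `u4t/port/tags_r11.json` 7935c0e35cdf68ee, census-2 port note P-B1);
bodies byte-identical to the scratch modulo docstrings — machine-verified by `split_r11.py --overlay`; census readings carry over).

CONTENT (Parts C–D). Part C: `ballInterval x w = {τ | |x + τw|² ≤ 1}` (`convex_ballInterval`), the
line function `lineFun U x Y c n τ = U(x + τ·dirW c n, Y + τ·dirK c n)`, the chord inequality
`split_of_lineConcave`, `ratioBound_of_lineConcave` ((S2) + (S1) + concavity of `lineFun` on the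
ball interval ⇒ `RatioBound θ`) and its C² form `lineConcave_of_deriv2_nonpos` /
`ratioBound_of_deriv2_nonpos` (Mathlib `concaveOn_of_deriv2_nonpos`). Part D:
`ratioBound_of_unitDir_deriv2` — (LC) is needed only at base points of the OPEN ball and only for
UNIT orthogonal generators `(c, n)` (bilinearity `dirW_smul_left` … `dirK_smul_right`, rescaling
`lineFun_scale` + `iterate_deriv_two_comp_mul`, re-basing `lineFun_shift`,
`dot_self_lt_one_of_mem_interior`, Lagrange `dirW_dot_self`; degenerate generators give a constant
line). Everything in this file is PROVED; hypotheses are binders.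

WORDS AT LANDING (LEAD (κκκκ)(iii)): records — conditional reduction: laminateSupConst ≤ theta1 GIVEN the two engine legs in the
engines' own charts; (C-b) cell-union arithmetic and (C-c) per-box engine soundness are NOT in the kernel; ‹C_lam ≤ 0.78› NOT
claimed (L4/L5 by format, referee, LEAD-human gate); numbers of record unchanged.  Every `def … : Prop` named `R18_…` / `Row…` /
`…Rows…` below is a HYPOTHESIS = an engine-certified (or pen) claim, NOT proved in this file unless a `…_holds` theorem says so.
-/

noncomputable section

open Matrix

namespace Summit.NavierStokesRegularity.FunctionalMining

namespace Laminate

/-! ## Part C — concavity along admissible lines inside the ball gives (S3) -/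

/-- The τ-interval of an admissible line through `x` in direction `w` that stays in the closed unit ball. [ours; bookkeeping] -/
def ballInterval (x w : Vec3) : Set ℝ := {τ : ℝ | (x + τ • w) ⬝ᵥ (x + τ • w) ≤ 1}

/-- The restriction of `U` to the admissible line through `(x, Y)` generated by `(c, n)`. [ours; bookkeeping] -/
def lineFun (U : Vec3 → Mat3 → ℝ) (x : Vec3) (Y : Mat3) (c n : Vec3) (τ : ℝ) : ℝ :=
  U (x + τ • dirW c n) (Y + τ • dirK c n)

/-- **(S3) from LINE CONCAVITY ON THE BALL** (K1Q1 §16.1 (S3) literally: along every admissible line `U` is concave on the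
part of the line inside the closed unit vorticity ball): the chord inequality at the three points `τ = −λ, 0, 1 − λ`.
[ours; elementary] -/
theorem split_of_lineConcave {U : Vec3 → Mat3 → ℝ}
    (hc : (∀ (x : Vec3) (Y : Mat3) (c n : Vec3), Y.IsSymm → Y.trace = 0 → c ⬝ᵥ n = 0 → x ⬝ᵥ x ≤ 1 →
      ConcaveOn ℝ (ballInterval x (dirW c n)) (lineFun U x Y c n))) :
    ∀ (x : Vec3) (Y : Mat3) (c n : Vec3) (l : ℝ), Y.IsSymm → Y.trace = 0 → c ⬝ᵥ n = 0 →
    0 < l → l < 1 → x ⬝ᵥ x ≤ 1 → (x + (1 - l) • dirW c n) ⬝ᵥ (x + (1 - l) • dirW c n) ≤ 1 →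
    (x + (-l) • dirW c n) ⬝ᵥ (x + (-l) • dirW c n) ≤ 1 →
    l * U (x + (1 - l) • dirW c n) (Y + (1 - l) • dirK c n)
      + (1 - l) * U (x + (-l) • dirW c n) (Y + (-l) • dirK c n) ≤ U x Y := by
  intro x Y c n l hY htr hcn hl0 hl1 hx hxp hxm
  have hconc := hc x Y c n hY htr hcn hx
  have hmemP : (1 - l) ∈ ballInterval x (dirW c n) := hxp
  have hmemM : (-l) ∈ ballInterval x (dirW c n) := hxm
  have key := hconc.2 hmemP hmemM (le_of_lt hl0) (by linarith : (0 : ℝ) ≤ 1 - l) (by ring)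
  have h0 : l • (1 - l) + (1 - l) • (-l) = (0 : ℝ) := by simp [smul_eq_mul]; ring
  rw [h0] at key
  simpa [lineFun, smul_eq_mul] using key

/-- **THE SUPERSOLUTION LEMMA with (S3) as line concavity** (K1Q1 §16.1 verbatim): `U(0,0) ≤ 0`, `φ_θ ≤ U` on the ball, and
concavity along admissible lines inside the ball give `RatioBound θ`. [ours; elementary] -/
theorem ratioBound_of_lineConcave {θ : ℝ} (U : Vec3 → Mat3 → ℝ) (hroot : U 0 0 ≤ 0)
    (hleaf : (∀ (x : Vec3) (Y : Mat3), Y.IsSymm → Y.trace = 0 → x ⬝ᵥ x ≤ 1 → payoff θ x Y ≤ U x Y))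
    (hconc : (∀ (x : Vec3) (Y : Mat3) (c n : Vec3), Y.IsSymm → Y.trace = 0 → c ⬝ᵥ n = 0 → x ⬝ᵥ x ≤ 1 →
      ConcaveOn ℝ (ballInterval x (dirW c n)) (lineFun U x Y c n)))
    : RatioBound θ :=
  ratioBound_of_supersolution U hroot hleaf (split_of_lineConcave hconc)

/-- The ball interval is convex (a sub-level set of a convex quadratic in `τ`). [ours; elementary] -/
theorem convex_ballInterval (x w : Vec3) : Convex ℝ (ballInterval x w) := by
  have hq : ∀ τ : ℝ, (x + τ • w) ⬝ᵥ (x + τ • w) = x ⬝ᵥ x + 2 * (x ⬝ᵥ w) * τ + (w ⬝ᵥ w) * τ ^ 2 := by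
    intro τ
    simp [dotProduct, Fin.sum_univ_three, smul_eq_mul]
    ring
  have hw : 0 ≤ w ⬝ᵥ w := by
    simp only [dotProduct, Fin.sum_univ_three]
    nlinarith [mul_self_nonneg (w 0), mul_self_nonneg (w 1), mul_self_nonneg (w 2)]
  rw [convex_iff_segment_subset]
  intro a ha b hb z hz
  rw [segment_eq_uIcc, Set.mem_uIcc] at hz
  simp only [ballInterval, Set.mem_setOf_eq, hq] at ha hb ⊢
  -- convexity of the quadratic `q`: on `[a, b]`, `(b−a)(1 − q z) = (b−z)(1 − q a) + (z−a)(1 − q b) + (w·w)(b−a)(b−z)(z−a)`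
  rcases hz with ⟨h1, h2⟩ | ⟨h1, h2⟩
  · by_cases hab : a = b
    · subst hab; have : z = a := le_antisymm h2 h1; subst this; exact ha
    have hlt : a < b := lt_of_le_of_ne (h1.trans h2) hab
    nlinarith [mul_nonneg (sub_nonneg.2 h2) (sub_nonneg.2 ha), mul_nonneg (sub_nonneg.2 h1) (sub_nonneg.2 hb),
      mul_nonneg (mul_nonneg hw (mul_nonneg (sub_nonneg.2 h1) (sub_nonneg.2 h2))) (sub_nonneg.2 hlt.le), hlt]
  · by_cases hab : a = b
    · subst hab; have : z = a := le_antisymm h2 h1; subst this; exact ha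
    have hlt : b < a := lt_of_le_of_ne (h1.trans h2) (Ne.symm hab)
    nlinarith [mul_nonneg (sub_nonneg.2 h2) (sub_nonneg.2 hb), mul_nonneg (sub_nonneg.2 h1) (sub_nonneg.2 ha),
      mul_nonneg (mul_nonneg hw (mul_nonneg (sub_nonneg.2 h1) (sub_nonneg.2 h2))) (sub_nonneg.2 hlt.le), hlt]

/-- **C² criterion (K1Q1 §16.2 (LC))**: if along every admissible line the restriction of `U` is continuous on the ball
interval, twice differentiable on its interior, with second derivative `≤ 0` there, then `U` is line-concave on the
ball (Mathlib `concaveOn_of_deriv2_nonpos`).  For `U = φ_θ + W` the second derivative of the line function is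
`2(ŵᵀYŵ − θ/2)|w|² + D²W[(w,K),(w,K)]` (`φ_θ'' ≡ 2(ŵᵀYŵ − θ/2)|w|²` on the line, K1Q1 §16.2), so the last hypothesis is
exactly (LC). [ours; elementary] -/
theorem lineConcave_of_deriv2_nonpos {U : Vec3 → Mat3 → ℝ}
    (hcont : ∀ (x : Vec3) (Y : Mat3) (c n : Vec3), Y.IsSymm → Y.trace = 0 → c ⬝ᵥ n = 0 → x ⬝ᵥ x ≤ 1 →
      ContinuousOn (lineFun U x Y c n) (ballInterval x (dirW c n)))
    (hd1 : ∀ (x : Vec3) (Y : Mat3) (c n : Vec3), Y.IsSymm → Y.trace = 0 → c ⬝ᵥ n = 0 → x ⬝ᵥ x ≤ 1 →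
      DifferentiableOn ℝ (lineFun U x Y c n) (interior (ballInterval x (dirW c n))))
    (hd2 : ∀ (x : Vec3) (Y : Mat3) (c n : Vec3), Y.IsSymm → Y.trace = 0 → c ⬝ᵥ n = 0 → x ⬝ᵥ x ≤ 1 →
      DifferentiableOn ℝ (deriv (lineFun U x Y c n)) (interior (ballInterval x (dirW c n))))
    (hLC : ∀ (x : Vec3) (Y : Mat3) (c n : Vec3), Y.IsSymm → Y.trace = 0 → c ⬝ᵥ n = 0 → x ⬝ᵥ x ≤ 1 →
      ∀ τ ∈ interior (ballInterval x (dirW c n)), deriv^[2] (lineFun U x Y c n) τ ≤ 0) :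
    ∀ (x : Vec3) (Y : Mat3) (c n : Vec3), Y.IsSymm → Y.trace = 0 → c ⬝ᵥ n = 0 → x ⬝ᵥ x ≤ 1 →
    ConcaveOn ℝ (ballInterval x (dirW c n)) (lineFun U x Y c n) := by
  intro x Y c n hY htr hcn hx
  exact concaveOn_of_deriv2_nonpos (convex_ballInterval x (dirW c n)) (hcont x Y c n hY htr hcn hx)
    (hd1 x Y c n hY htr hcn hx) (hd2 x Y c n hY htr hcn hx) (hLC x Y c n hY htr hcn hx)

/-- **THE SUPERSOLUTION LEMMA, C² form** (K1Q1 §16.2): (S2) + (S1) + the line-wise regularity and the second-derivative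
bound (LC) on the closed ball give `RatioBound θ` (so `laminateSupConst ≤ θ`).  This is the statement the R18 legs
instantiate: (S1) ← `TRS-S1` certificate + Lemmas A–E, (LC) ← LC-core/shell certificates + the far-field lemma, (S2) by
evaluation.  Search for candidate a priori estimates; no regularity claim. [ours; elementary] -/
theorem ratioBound_of_deriv2_nonpos {θ : ℝ} (U : Vec3 → Mat3 → ℝ) (hroot : U 0 0 ≤ 0)
    (hleaf : (∀ (x : Vec3) (Y : Mat3), Y.IsSymm → Y.trace = 0 → x ⬝ᵥ x ≤ 1 → payoff θ x Y ≤ U x Y))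
    (hcont : ∀ (x : Vec3) (Y : Mat3) (c n : Vec3), Y.IsSymm → Y.trace = 0 → c ⬝ᵥ n = 0 → x ⬝ᵥ x ≤ 1 →
      ContinuousOn (lineFun U x Y c n) (ballInterval x (dirW c n)))
    (hd1 : ∀ (x : Vec3) (Y : Mat3) (c n : Vec3), Y.IsSymm → Y.trace = 0 → c ⬝ᵥ n = 0 → x ⬝ᵥ x ≤ 1 →
      DifferentiableOn ℝ (lineFun U x Y c n) (interior (ballInterval x (dirW c n))))
    (hd2 : ∀ (x : Vec3) (Y : Mat3) (c n : Vec3), Y.IsSymm → Y.trace = 0 → c ⬝ᵥ n = 0 → x ⬝ᵥ x ≤ 1 →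
      DifferentiableOn ℝ (deriv (lineFun U x Y c n)) (interior (ballInterval x (dirW c n))))
    (hLC : ∀ (x : Vec3) (Y : Mat3) (c n : Vec3), Y.IsSymm → Y.trace = 0 → c ⬝ᵥ n = 0 → x ⬝ᵥ x ≤ 1 →
      ∀ τ ∈ interior (ballInterval x (dirW c n)), deriv^[2] (lineFun U x Y c n) τ ≤ 0) :
    RatioBound θ :=
  ratioBound_of_lineConcave U hroot hleaf (lineConcave_of_deriv2_nonpos hcont hd1 hd2 hLC)

/-! ## Part D — (LC) at points of the OPEN ball in UNIT admissible directions (the shape the engines certify) -/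

section unitDirections

/-- `|v|² = v₀² + v₁² + v₂²` on `Fin 3 → ℝ`. [ours; bookkeeping] -/
theorem vec3_dot_self (v : Vec3) : v ⬝ᵥ v = v 0 ^ 2 + v 1 ^ 2 + v 2 ^ 2 := by
  simp [dotProduct, Fin.sum_univ_three]; ring

/-- `0 ≤ |v|²`. [ours; bookkeeping] -/
theorem vec3_dot_self_nonneg (v : Vec3) : 0 ≤ v ⬝ᵥ v := by
  rw [vec3_dot_self]; positivity

/-- `|v|² = 0 → v = 0`. [ours; bookkeeping] -/
theorem vec3_eq_zero_of_dot_self_eq_zero {v : Vec3} (h : v ⬝ᵥ v = 0) : v = 0 := by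
  rw [vec3_dot_self] at h
  have h0 : v 0 = 0 := by nlinarith [sq_nonneg (v 0), sq_nonneg (v 1), sq_nonneg (v 2)]
  have h1 : v 1 = 0 := by nlinarith [sq_nonneg (v 0), sq_nonneg (v 1), sq_nonneg (v 2)]
  have h2 : v 2 = 0 := by nlinarith [sq_nonneg (v 0), sq_nonneg (v 1), sq_nonneg (v 2)]
  funext i; fin_cases i <;> simp [h0, h1, h2]

/-- `dirW` is linear in `c`. [ours; bookkeeping] -/
theorem dirW_smul_left (a : ℝ) (c n : Vec3) : dirW (a • c) n = a • dirW c n := by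
  ext i; fin_cases i <;> simp [dirW, smul_eq_mul] <;> ring

/-- `dirW` is linear in `n`. [ours; bookkeeping] -/
theorem dirW_smul_right (b : ℝ) (c n : Vec3) : dirW c (b • n) = b • dirW c n := by
  ext i; fin_cases i <;> simp [dirW, smul_eq_mul] <;> ring

/-- `dirK` is linear in `c`. [ours; bookkeeping] -/
theorem dirK_smul_left (a : ℝ) (c n : Vec3) : dirK (a • c) n = a • dirK c n := by
  ext i j; fin_cases i <;> fin_cases j <;> simp [dirK, smul_eq_mul] <;> ring

/-- `dirK` is linear in `n`. [ours; bookkeeping] -/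
theorem dirK_smul_right (b : ℝ) (c n : Vec3) : dirK c (b • n) = b • dirK c n := by
  ext i j; fin_cases i <;> fin_cases j <;> simp [dirK, smul_eq_mul] <;> ring

/-- `dirW 0 n = 0`. [ours; bookkeeping] -/
theorem dirW_zero_left (n : Vec3) : dirW 0 n = 0 := by
  ext i; fin_cases i <;> simp [dirW]

/-- `dirW c 0 = 0`. [ours; bookkeeping] -/
theorem dirW_zero_right (c : Vec3) : dirW c 0 = 0 := by
  ext i; fin_cases i <;> simp [dirW]

/-- `dirK 0 n = 0`. [ours; bookkeeping] -/
theorem dirK_zero_left (n : Vec3) : dirK 0 n = 0 := by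
  ext i j; fin_cases i <;> fin_cases j <;> simp [dirK]

/-- `dirK c 0 = 0`. [ours; bookkeeping] -/
theorem dirK_zero_right (c : Vec3) : dirK c 0 = 0 := by
  ext i j; fin_cases i <;> fin_cases j <;> simp [dirK]

/-- `tr sym(c ⊗ n) = c·n`. [ours; bookkeeping] -/
theorem dirK_trace (c n : Vec3) : (dirK c n).trace = c ⬝ᵥ n := by
  simp [dirK, Matrix.trace, Fin.sum_univ_three, dotProduct]

/-- `sym(c ⊗ n)` is symmetric. [ours; bookkeeping] -/
theorem dirK_isSymm (c n : Vec3) : (dirK c n).IsSymm := by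
  refine Matrix.IsSymm.ext ?_
  intro i j; fin_cases i <;> fin_cases j <;> simp [dirK, mul_comm]

/-- Lagrange's identity `|n × c|² = |c|²|n|² − (c·n)²`. [ours; elementary] -/
theorem dirW_dot_self (c n : Vec3) : dirW c n ⬝ᵥ dirW c n = (c ⬝ᵥ c) * (n ⬝ᵥ n) - (c ⬝ᵥ n) ^ 2 := by
  simp [dirW, dotProduct, Fin.sum_univ_three]; ring

/-- Re-basing a line at one of its points is a translation of the parameter. [ours; bookkeeping] -/
theorem lineFun_shift (U : Vec3 → Mat3 → ℝ) (x : Vec3) (Y : Mat3) (c n : Vec3) (τ : ℝ) :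
    lineFun U (x + τ • dirW c n) (Y + τ • dirK c n) c n = fun s => lineFun U x Y c n (s + τ) := by
  funext s
  simp only [lineFun, add_smul]
  congr 1 <;> abel

/-- Scaling the generators `(c, n) ↦ (a c, b n)` rescales the parameter by `a b`. [ours; bookkeeping] -/
theorem lineFun_scale (U : Vec3 → Mat3 → ℝ) (x : Vec3) (Y : Mat3) (c n : Vec3) (a b : ℝ) :
    lineFun U x Y (a • c) (b • n) = fun s => lineFun U x Y c n (a * b * s) := by
  funext s
  simp only [lineFun, dirW_smul_left, dirW_smul_right, dirK_smul_left, dirK_smul_right, smul_smul]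
  congr 1 <;> congr 1 <;> congr 1 <;> ring

/-- Second derivative under a linear change of parameter (no differentiability needed: Mathlib's `deriv` junk values are
compatible). [ours; elementary] -/
theorem iterate_deriv_two_comp_mul (g : ℝ → ℝ) (κ τ : ℝ) :
    deriv^[2] (fun s => g (κ * s)) τ = κ ^ 2 * deriv^[2] g (κ * τ) := by
  have h1 : deriv (fun s => g (κ * s)) = fun s => κ * deriv g (κ * s) := by
    funext s; exact deriv_comp_mul_left κ g s
  show deriv (deriv (fun s => g (κ * s))) τ = κ ^ 2 * deriv (deriv g) (κ * τ)
  rw [h1, deriv_const_mul_field, deriv_comp_mul_left κ (deriv g) τ, smul_eq_mul]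
  ring

/-- A parameter in the INTERIOR of the ball interval of a non-degenerate line is a point of the OPEN ball. [ours; elementary] -/
theorem dot_self_lt_one_of_mem_interior {x w : Vec3} (hw : 0 < w ⬝ᵥ w) {τ : ℝ}
    (hτ : τ ∈ interior (ballInterval x w)) : (x + τ • w) ⬝ᵥ (x + τ • w) < 1 := by
  have hq : ∀ s : ℝ, (x + s • w) ⬝ᵥ (x + s • w) = x ⬝ᵥ x + 2 * (x ⬝ᵥ w) * s + (w ⬝ᵥ w) * s ^ 2 := by
    intro s
    simp [dotProduct, Fin.sum_univ_three, smul_eq_mul]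
    ring
  rw [mem_interior_iff_mem_nhds, Metric.mem_nhds_iff] at hτ
  obtain ⟨ε, hε, hball⟩ := hτ
  have hp : τ + ε / 2 ∈ ballInterval x w := hball (by
    rw [Metric.mem_ball, Real.dist_eq]; rw [show τ + ε / 2 - τ = ε / 2 by ring, abs_of_pos (by linarith)]; linarith)
  have hm : τ - ε / 2 ∈ ballInterval x w := hball (by
    rw [Metric.mem_ball, Real.dist_eq]; rw [show τ - ε / 2 - τ = -(ε / 2) by ring, abs_neg, abs_of_pos (by linarith)];
    linarith)
  simp only [ballInterval, Set.mem_setOf_eq, hq] at hp hm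
  rw [hq]
  nlinarith [mul_pos hw (pow_pos hε 2)]

/-- **THE SUPERSOLUTION LEMMA, certified shape** (K1Q1 §16.2 as the engines state it): `U` with (S2), (S1), `C²` along every
line, and (LC) in the form «second derivative at the base point `≤ 0` for every base point of the OPEN unit ball and every
UNIT admissible pair `|c| = |n| = 1`, `c ⊥ n`» (then `w = n × c` is a unit vector, `K = sym(c⊗n) = ½(e₊e₊ᵀ − e₋e₋ᵀ)` with
`e± = (c ± n)/√2`, i.e. exactly the `(ŵ, T_γ)` directions of the bank's LC engines) gives `RatioBound θ`.  General admissible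
pairs reduce to unit ones by bilinearity of `(dirW, dirK)` and the `κ²`-scaling of second derivatives; interior parameters
of the ball interval are points of the open ball. [ours; elementary] -/
theorem ratioBound_of_unitDir_deriv2 {θ : ℝ} (U : Vec3 → Mat3 → ℝ) (hroot : U 0 0 ≤ 0)
    (hleaf : ∀ (x : Vec3) (Y : Mat3), Y.IsSymm → Y.trace = 0 → x ⬝ᵥ x ≤ 1 → payoff θ x Y ≤ U x Y)
    (hsmooth : ∀ (x : Vec3) (Y : Mat3) (c n : Vec3), Y.IsSymm → Y.trace = 0 → c ⬝ᵥ n = 0 →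
      ContDiff ℝ 2 (lineFun U x Y c n))
    (hLC : ∀ (x : Vec3) (Y : Mat3) (c n : Vec3), Y.IsSymm → Y.trace = 0 → c ⬝ᵥ c = 1 → n ⬝ᵥ n = 1 → c ⬝ᵥ n = 0 →
      x ⬝ᵥ x < 1 → iteratedDeriv 2 (lineFun U x Y c n) 0 ≤ 0) :
    RatioBound θ := by
  refine ratioBound_of_deriv2_nonpos U hroot hleaf ?_ ?_ ?_ ?_
  · intro x Y c n hY htr hcn _; exact (hsmooth x Y c n hY htr hcn).continuous.continuousOn
  · intro x Y c n hY htr hcn _; exact ((hsmooth x Y c n hY htr hcn).differentiable (by norm_num)).differentiableOn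
  · intro x Y c n hY htr hcn _; exact (hsmooth x Y c n hY htr hcn).differentiable_deriv_two.differentiableOn
  · intro x Y c n hY htr hcn _hx τ hτ
    by_cases hdeg : c ⬝ᵥ c = 0 ∨ n ⬝ᵥ n = 0
    · -- degenerate generator: the line is a point, the line function is constant
      have hconst : lineFun U x Y c n = fun _ => U x Y := by
        rcases hdeg with h0 | h0
        · have := vec3_eq_zero_of_dot_self_eq_zero h0; subst this
          funext s; simp [lineFun, dirW_zero_left, dirK_zero_left]
        · have := vec3_eq_zero_of_dot_self_eq_zero h0; subst this
          funext s; simp [lineFun, dirW_zero_right, dirK_zero_right]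
      show deriv (deriv (lineFun U x Y c n)) τ ≤ 0
      rw [hconst]; simp
    · have hc0 : c ⬝ᵥ c ≠ 0 := fun h => hdeg (Or.inl h)
      have hn0 : n ⬝ᵥ n ≠ 0 := fun h => hdeg (Or.inr h)
      have hcpos : 0 < c ⬝ᵥ c := lt_of_le_of_ne (vec3_dot_self_nonneg c) (Ne.symm hc0)
      have hnpos : 0 < n ⬝ᵥ n := lt_of_le_of_ne (vec3_dot_self_nonneg n) (Ne.symm hn0)
      set a : ℝ := Real.sqrt (c ⬝ᵥ c) with ha
      set b : ℝ := Real.sqrt (n ⬝ᵥ n) with hb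
      have hapos : 0 < a := Real.sqrt_pos.mpr hcpos
      have hbpos : 0 < b := Real.sqrt_pos.mpr hnpos
      have ha2 : a ^ 2 = c ⬝ᵥ c := Real.sq_sqrt hcpos.le
      have hb2 : b ^ 2 = n ⬝ᵥ n := Real.sq_sqrt hnpos.le
      set c' : Vec3 := a⁻¹ • c with hc'
      set n' : Vec3 := b⁻¹ • n with hn'
      have hcc : c = a • c' := by rw [hc', smul_smul, mul_inv_cancel₀ hapos.ne', one_smul]
      have hnn : n = b • n' := by rw [hn', smul_smul, mul_inv_cancel₀ hbpos.ne', one_smul]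
      have hc'1 : c' ⬝ᵥ c' = 1 := by
        rw [hc', smul_dotProduct, dotProduct_smul, smul_eq_mul, smul_eq_mul, ← ha2]; field_simp
      have hn'1 : n' ⬝ᵥ n' = 1 := by
        rw [hn', smul_dotProduct, dotProduct_smul, smul_eq_mul, smul_eq_mul, ← hb2]; field_simp
      have hc'n' : c' ⬝ᵥ n' = 0 := by
        rw [hc', hn', smul_dotProduct, dotProduct_smul, smul_eq_mul, smul_eq_mul, hcn]; simp
      set κ : ℝ := a * b with hκ
      -- the line function in terms of the unit generators
      have hscale : lineFun U x Y c n = fun s => lineFun U x Y c' n' (κ * s) := by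
        rw [hcc, hnn, lineFun_scale]
      -- base point of the shifted line
      set x' : Vec3 := x + (κ * τ) • dirW c' n' with hx'
      set Y' : Mat3 := Y + (κ * τ) • dirK c' n' with hY'
      have hwx : (κ * τ) • dirW c' n' = τ • dirW c n := by
        rw [hc', hn', dirW_smul_left, dirW_smul_right, smul_smul, smul_smul]
        congr 1
        rw [hκ]; field_simp
      have hY's : Y'.IsSymm := hY.add ((dirK_isSymm c' n').smul _)
      have hY't : Y'.trace = 0 := by
        rw [hY', Matrix.trace_add, Matrix.trace_smul, dirK_trace, hc'n', htr]; simp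
      have hwpos : 0 < dirW c n ⬝ᵥ dirW c n := by
        rw [dirW_dot_self, hcn]; nlinarith [mul_pos hcpos hnpos]
      have hx'1 : x' ⬝ᵥ x' < 1 := by
        rw [hx', hwx]; exact dot_self_lt_one_of_mem_interior hwpos hτ
      have key := hLC x' Y' c' n' hY's hY't hc'1 hn'1 hc'n' hx'1
      -- transport: ∂²(lineFun c n) at τ = κ² · ∂²(lineFun c' n') at κτ = κ² · ∂²(shifted line) at 0
      have hshift : iteratedDeriv 2 (lineFun U x' Y' c' n') 0 = iteratedDeriv 2 (lineFun U x Y c' n') (κ * τ) := by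
        rw [hx', hY', lineFun_shift, iteratedDeriv_comp_add_const]; simp
      rw [hscale, iterate_deriv_two_comp_mul, ← iteratedDeriv_eq_iterate, ← hshift]
      exact mul_nonpos_of_nonneg_of_nonpos (sq_nonneg κ) key

end unitDirections

end Laminate

end Summit.NavierStokesRegularity.FunctionalMining

end
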